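import Mathlib

/-!
# `BalabanUV.Beta.GAN24.InverseRate` — binder row G-an2-4 / (CONV-C), road P1-fibre, typer row **P1-E4** (node N17e of `GAN24/Formal/DAG.md` v2):
# the RATE ENGINE of Part B (B3/B4 of `SKELETON-P1.md`) — resolvent differences, product telescoping and geometric one-step rates for
# finite complex matrices, in ONE submultiplicative norm currency with entrywise comparison

NOT IN PRINT; OUR PROOF ATTEMPT.  HONEST FRAMING (cell contract, verbatim): «discharging `BetaPertH` makes Bałaban's UV stability UNCONDITIONAL — a real
constructive-QFT result; it is NOT the continuum limit and NOT the Clay problem.»  HONEST DEPENDENCY (verbatim): «continuum YM on T⁴ ⇐ BetaPertH ∧ nine spine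
estimates (0/9 proved); BetaPertH ⇐ (D1) ∧ (D4) ∧ CAP+tail; G-an2-4 gates asym, D1 and NE2/3/4.»  [folklore] finite-dimensional matrix analysis over `ℂ` (Mathlib
only; no estimate specific to the fibre system, no cited fact, no wall binder).  By itself this file discharges NOTHING of (CONV-C)'s K-slot.  NOT summit progress.

## Rôle in the route
Part B of road P1 proves the real-zone one-step rate `‖kFib_{j+1}(p) − kFib_j(p)‖ ≤ c·θ^j` (row P1-L11, feeding `CombesThomasFibreStep.supRateK_of_kFib`) by
(B3) «level-(j+1) quantity − level-j quantity = O(θ^j)» for each factor of the closed form S1b′ (blocks `T(k_m)⁻¹`, border/reading weights, the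
`(D+1)×(D+1)` capacitance matrix `Cap_j(p)`) and (B4) assembly.  The two generic mechanisms are King's (4.39)–(4.41) pattern
(C. King, CMP 103 (1986) 323–349 — pattern only, nothing of it is used or cited here): the RESOLVENT IDENTITY `A⁻¹ − B⁻¹ = A⁻¹(B − A)B⁻¹` turns a rate for
`Cap_j` plus a UNIFORM bound on `Cap_j⁻¹` (row P1-L08) into a rate for `Cap_j⁻¹`, and PRODUCT TELESCOPING turns factor rates into a rate for sandwiches
`R_j · Cap_j⁻¹ · R′_j`.  This file supplies exactly these mechanisms, once, for arbitrary finite index types (rectangular factors allowed), so that rows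
P1-L11a/L11b*/L11 only have to verify their hypotheses (factor bounds and factor rates) in the alias-sum objects of `GAN24/AliasObjects` (row P1-T00).
The tree's `King1986.CovarianceRate.inv_sub_inv_of_isUnit` / `abs_covOp_sub_covOp_le` are the REAL-matrix, quadratic-form versions; gan24-p1's row P1-L11a
(`GAN24/ResolventDifference`, leaf-20) is the ENTRYWISE version with dimension factors; neither is restated here.

## Norm currency (read this before importing)
All norms of matrices in this file are Mathlib's `ℓ∞`-OPERATOR NORM `‖A‖ = sup_i Σ_j ‖A i j‖` (`Matrix.linftyOpNormedAddCommGroup` / `…NormedRing`,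
activated by `open scoped Matrix.Norms.Operator`; it is the operator norm of `A.mulVec` between sup-normed spaces, `Matrix.linfty_opNorm_eq_opNorm`).  It is
submultiplicative for RECTANGULAR products (`Matrix.linfty_opNorm_mul`), dominates every entry and is dominated by `card × (entry bound)` (§1) — so a consumer
working entrywise converts at the start and at the end and loses only dimension factors of the FIXED finite index (`D+1` for the capacitance matrix).
A consumer must open the same scope (`open scoped Matrix.Norms.Operator`) to read the statements in this currency.

## Contents
§1 currency: `norm_entry_le`, `sum_row_le_norm`, `norm_le_of_row_sum_le`, `norm_le_card_mul`, `norm_mulVec_entry_le`.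
§2 resolvent step (B3 for `Cap⁻¹`): `norm_inv_sub_inv_le` (`‖A⁻¹ − B⁻¹‖ ≤ ‖A⁻¹‖·‖B − A‖·‖B⁻¹‖`, via Mathlib's `Matrix.inv_sub_inv`), `…_of_isUnit_det`, `…_of_bounds`.
§3 telescoping (B4): `mul2_sub_mul2`, `mul3_sub_mul3` and their norm bounds with displayed constants (rectangular factors).
§4 geometric families (B3/B4 in `θ^j` form): `norm_inv_succ_sub_inv_le` (`‖A_{j+1} − A_j‖ ≤ aθ^j`, `‖A_j⁻¹‖ ≤ K` ⇒ `‖A_{j+1}⁻¹ − A_j⁻¹‖ ≤ K²aθ^j`),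
   `norm_mul3_succ_sub_le` (factor rates ⇒ sandwich rate `(dr·y·z + x·dy·z + x·y·dz)θ^j`), `norm_sandwich_inv_succ_sub_le` (the two combined).
§5 from one-step rates to tails (any complete normed group; used with `θ = Lc⁻²`): `norm_sub_le_of_step_rate` (`‖F_{j+k} − F_j‖ ≤ cθ^j/(1−θ)`),
   `exists_limit_of_step_rate` (limit `F∞` with `‖F_j − F∞‖ ≤ cθ^j/(1−θ)`).
-/

open Finset Filter Topology
open scoped BigOperators NNReal Matrix.Norms.Operator

namespace Summit.QuantumFields.BalabanUV.Beta.GAN24.InverseRate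

variable {l m n p : Type*} [Fintype l] [Fintype m] [Fintype n] [Fintype p]

/-! ## §1 The currency: `ℓ∞`-operator norm versus entries (any seminormed coefficient group `α`; used at `α = ℂ`) -/

section Currency

variable {α : Type*} [SeminormedAddCommGroup α]

/-- [folklore] A row sum of entry norms is bounded by the `ℓ∞`-operator norm: `Σ_j ‖A i j‖ ≤ ‖A‖`. -/
theorem sum_row_le_norm (A : Matrix m n α) (i : m) : ∑ j, ‖A i j‖ ≤ ‖A‖ := by
  have h : (∑ j, ‖A i j‖₊) ≤ ‖A‖₊ := by
    rw [Matrix.linfty_opNNNorm_def]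
    exact Finset.le_sup (f := fun i : m => ∑ j : n, ‖A i j‖₊) (Finset.mem_univ i)
  have := NNReal.coe_le_coe.mpr h
  push_cast at this
  exact this

/-- [folklore] Every entry is bounded by the `ℓ∞`-operator norm: `‖A i j‖ ≤ Σ_j' ‖A i j'‖ ≤ ‖A‖` (stated for a general seminormed coefficient
group; NOT the `L²`-operator-norm lemma of the same shape elsewhere in the tree — the norm instance differs). -/
theorem norm_entry_le (A : Matrix m n α) (i : m) (j : n) : ‖A i j‖ ≤ ‖A‖ :=
  le_trans (Finset.single_le_sum (f := fun j' => ‖A i j'‖) (fun _ _ => norm_nonneg _) (Finset.mem_univ j))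
    (sum_row_le_norm A i)

/-- [folklore] ROW-SUM CRITERION: if every row sum of entry norms is `≤ C` (`C ≥ 0`) then `‖A‖ ≤ C`. -/
theorem norm_le_of_row_sum_le (A : Matrix m n α) {C : ℝ} (hC : 0 ≤ C) (h : ∀ i, ∑ j, ‖A i j‖ ≤ C) : ‖A‖ ≤ C := by
  have key : ‖A‖₊ ≤ ⟨C, hC⟩ := by
    rw [Matrix.linfty_opNNNorm_def]
    refine Finset.sup_le fun i _ => ?_
    rw [← NNReal.coe_le_coe]
    push_cast
    exact h i
  exact NNReal.coe_le_coe.mpr key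

/-- [folklore] ENTRYWISE ⇒ OPERATOR NORM: a uniform entry bound `c` gives `‖A‖ ≤ card(columns)·c`. -/
theorem norm_le_card_mul (A : Matrix m n α) {c : ℝ} (hc : 0 ≤ c) (h : ∀ i j, ‖A i j‖ ≤ c) :
    ‖A‖ ≤ Fintype.card n * c := by
  refine norm_le_of_row_sum_le A (by positivity) fun i => ?_
  calc ∑ j, ‖A i j‖ ≤ ∑ _j : n, c := Finset.sum_le_sum fun j _ => h i j
    _ = Fintype.card n * c := by rw [Finset.sum_const, Finset.card_univ, nsmul_eq_mul]

end Currency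

/-- [folklore] Matrix-on-vector bound, entrywise on the output: `‖(A v) i‖ ≤ ‖A‖ · sup_j ‖v j‖` (the vector norm is the sup norm). -/
theorem norm_mulVec_entry_le {α : Type*} [NonUnitalSeminormedRing α] (A : Matrix m n α) (v : n → α) (i : m) :
    ‖(A.mulVec v) i‖ ≤ ‖A‖ * ‖v‖ :=
  (norm_le_pi_norm (A.mulVec v) i).trans (Matrix.linfty_opNorm_mulVec A v)

/-! ## §2 The resolvent step (B3 for the capacitance inverse) -/

section Resolvent

variable [DecidableEq n]

/-- [folklore] **RESOLVENT BOUND**: `‖A⁻¹ − B⁻¹‖ ≤ ‖A⁻¹‖·‖B − A‖·‖B⁻¹‖` whenever `A` and `B` are simultaneously invertible or simultaneously singular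
(Mathlib's `Matrix.inv_sub_inv`: `A⁻¹ − B⁻¹ = A⁻¹ (B − A) B⁻¹`; for singular pairs both sides vanish). -/
theorem norm_inv_sub_inv_le (A B : Matrix n n ℂ) (h : IsUnit A ↔ IsUnit B) :
    ‖A⁻¹ - B⁻¹‖ ≤ ‖A⁻¹‖ * ‖B - A‖ * ‖B⁻¹‖ := by
  rw [Matrix.inv_sub_inv h]
  exact (norm_mul_le _ _).trans (mul_le_mul_of_nonneg_right (norm_mul_le _ _) (norm_nonneg _))

/-- [folklore] The same under the usual hypotheses `IsUnit A.det`, `IsUnit B.det`. -/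
theorem norm_inv_sub_inv_le_of_isUnit_det (A B : Matrix n n ℂ) (hA : IsUnit A.det) (hB : IsUnit B.det) :
    ‖A⁻¹ - B⁻¹‖ ≤ ‖A⁻¹‖ * ‖B - A‖ * ‖B⁻¹‖ :=
  norm_inv_sub_inv_le A B
    ⟨fun _ => (Matrix.isUnit_iff_isUnit_det B).mpr hB, fun _ => (Matrix.isUnit_iff_isUnit_det A).mpr hA⟩

/-- [folklore] **RESOLVENT BOUND WITH CONSTANTS**: `‖A⁻¹‖ ≤ a`, `‖B⁻¹‖ ≤ b`, `‖A − B‖ ≤ ε` ⇒ `‖A⁻¹ − B⁻¹‖ ≤ a·ε·b`. -/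
theorem norm_inv_sub_inv_le_of_bounds (A B : Matrix n n ℂ) (hA : IsUnit A.det) (hB : IsUnit B.det) {a b ε : ℝ}
    (ha : ‖A⁻¹‖ ≤ a) (hb : ‖B⁻¹‖ ≤ b) (hε : ‖A - B‖ ≤ ε) : ‖A⁻¹ - B⁻¹‖ ≤ a * ε * b := by
  have hε' : ‖B - A‖ ≤ ε := by rwa [norm_sub_rev]
  calc ‖A⁻¹ - B⁻¹‖ ≤ ‖A⁻¹‖ * ‖B - A‖ * ‖B⁻¹‖ := norm_inv_sub_inv_le_of_isUnit_det A B hA hB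
    _ ≤ a * ε * b := by
        have h0 : 0 ≤ a := (norm_nonneg _).trans ha
        have h1 : 0 ≤ ε := (norm_nonneg _).trans hε'
        have h2 : 0 ≤ a * ε := mul_nonneg h0 h1
        gcongr

end Resolvent

/-! ## §3 Product telescoping (B4), rectangular factors -/

omit [Fintype l] [Fintype n] in
/-- [folklore] Two-factor telescoping identity. -/
theorem mul2_sub_mul2 (X₁ X₀ : Matrix l m ℂ) (Y₁ Y₀ : Matrix m n ℂ) :
    X₁ * Y₁ - X₀ * Y₀ = (X₁ - X₀) * Y₁ + X₀ * (Y₁ - Y₀) := by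
  simp only [Matrix.sub_mul, Matrix.mul_sub]; abel

/-- [folklore] Two-factor telescoping bound: `‖X₁Y₁ − X₀Y₀‖ ≤ ‖X₁ − X₀‖·‖Y₁‖ + ‖X₀‖·‖Y₁ − Y₀‖`. -/
theorem norm_mul2_sub_mul2_le (X₁ X₀ : Matrix l m ℂ) (Y₁ Y₀ : Matrix m n ℂ) :
    ‖X₁ * Y₁ - X₀ * Y₀‖ ≤ ‖X₁ - X₀‖ * ‖Y₁‖ + ‖X₀‖ * ‖Y₁ - Y₀‖ := by
  rw [mul2_sub_mul2]
  exact (norm_add_le _ _).trans (add_le_add (Matrix.linfty_opNorm_mul _ _) (Matrix.linfty_opNorm_mul _ _))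

omit [Fintype l] [Fintype p] in
/-- [folklore] Three-factor telescoping identity `X₁Y₁Z₁ − X₀Y₀Z₀ = (X₁−X₀)Y₁Z₁ + X₀(Y₁−Y₀)Z₁ + X₀Y₀(Z₁−Z₀)`. -/
theorem mul3_sub_mul3 (X₁ X₀ : Matrix l m ℂ) (Y₁ Y₀ : Matrix m n ℂ) (Z₁ Z₀ : Matrix n p ℂ) :
    X₁ * Y₁ * Z₁ - X₀ * Y₀ * Z₀ = (X₁ - X₀) * Y₁ * Z₁ + X₀ * (Y₁ - Y₀) * Z₁ + X₀ * Y₀ * (Z₁ - Z₀) := by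
  simp only [Matrix.sub_mul, Matrix.mul_sub]; abel

/-- [folklore] Norm of a triple product (rectangular): `‖XYZ‖ ≤ ‖X‖‖Y‖‖Z‖`. -/
theorem norm_mul3_le (X : Matrix l m ℂ) (Y : Matrix m n ℂ) (Z : Matrix n p ℂ) : ‖X * Y * Z‖ ≤ ‖X‖ * ‖Y‖ * ‖Z‖ :=
  (Matrix.linfty_opNorm_mul _ _).trans (mul_le_mul_of_nonneg_right (Matrix.linfty_opNorm_mul _ _) (norm_nonneg _))

/-- [folklore] **THREE-FACTOR TELESCOPING BOUND**:
`‖X₁Y₁Z₁ − X₀Y₀Z₀‖ ≤ ‖X₁−X₀‖‖Y₁‖‖Z₁‖ + ‖X₀‖‖Y₁−Y₀‖‖Z₁‖ + ‖X₀‖‖Y₀‖‖Z₁−Z₀‖`. -/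
theorem norm_mul3_sub_mul3_le (X₁ X₀ : Matrix l m ℂ) (Y₁ Y₀ : Matrix m n ℂ) (Z₁ Z₀ : Matrix n p ℂ) :
    ‖X₁ * Y₁ * Z₁ - X₀ * Y₀ * Z₀‖
      ≤ ‖X₁ - X₀‖ * ‖Y₁‖ * ‖Z₁‖ + ‖X₀‖ * ‖Y₁ - Y₀‖ * ‖Z₁‖ + ‖X₀‖ * ‖Y₀‖ * ‖Z₁ - Z₀‖ := by
  rw [mul3_sub_mul3]
  exact (norm_add₃_le).trans (add_le_add (add_le_add (norm_mul3_le _ _ _) (norm_mul3_le _ _ _)) (norm_mul3_le _ _ _))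

/-- [folklore] **THREE-FACTOR TELESCOPING WITH CONSTANTS**: uniform factor bounds `x, y, z` and difference bounds `dx, dy, dz` give
`‖X₁Y₁Z₁ − X₀Y₀Z₀‖ ≤ dx·y·z + x·dy·z + x·y·dz`. -/
theorem norm_mul3_sub_mul3_le_of_bounds (X₁ X₀ : Matrix l m ℂ) (Y₁ Y₀ : Matrix m n ℂ) (Z₁ Z₀ : Matrix n p ℂ)
    {x y z dx dy dz : ℝ} (hx : ‖X₀‖ ≤ x) (hy₁ : ‖Y₁‖ ≤ y) (hy₀ : ‖Y₀‖ ≤ y) (hz : ‖Z₁‖ ≤ z)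
    (hdx : ‖X₁ - X₀‖ ≤ dx) (hdy : ‖Y₁ - Y₀‖ ≤ dy) (hdz : ‖Z₁ - Z₀‖ ≤ dz) :
    ‖X₁ * Y₁ * Z₁ - X₀ * Y₀ * Z₀‖ ≤ dx * y * z + x * dy * z + x * y * dz := by
  have h0x : 0 ≤ x := (norm_nonneg _).trans hx
  have h0y : 0 ≤ y := (norm_nonneg _).trans hy₁
  have h0z : 0 ≤ z := (norm_nonneg _).trans hz
  have h0dx : 0 ≤ dx := (norm_nonneg _).trans hdx
  have h0dy : 0 ≤ dy := (norm_nonneg _).trans hdy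
  calc ‖X₁ * Y₁ * Z₁ - X₀ * Y₀ * Z₀‖
      ≤ ‖X₁ - X₀‖ * ‖Y₁‖ * ‖Z₁‖ + ‖X₀‖ * ‖Y₁ - Y₀‖ * ‖Z₁‖ + ‖X₀‖ * ‖Y₀‖ * ‖Z₁ - Z₀‖ := norm_mul3_sub_mul3_le _ _ _ _ _ _
    _ ≤ dx * y * z + x * dy * z + x * y * dz := by
        have h1 : 0 ≤ dx * y := mul_nonneg h0dx h0y
        have h2 : 0 ≤ x * dy := mul_nonneg h0x h0dy
        have h3 : 0 ≤ x * y := mul_nonneg h0x h0y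
        gcongr

/-! ## §4 Geometric families: one-step rates `θ^j` -/

section Geometric

variable [DecidableEq n]

/-- [folklore] **GEOMETRIC RESOLVENT RATE** (King (4.40) pattern): if `‖A_{j+1} − A_j‖ ≤ a·θ^j` and `‖A_j⁻¹‖ ≤ K` for all `j` (all `A_j` invertible),
then `‖A_{j+1}⁻¹ − A_j⁻¹‖ ≤ K²·a·θ^j`. -/
theorem norm_inv_succ_sub_inv_le (A : ℕ → Matrix n n ℂ) (hU : ∀ j, IsUnit (A j).det) {K a θ : ℝ}
    (hK : ∀ j, ‖(A j)⁻¹‖ ≤ K) (hstep : ∀ j, ‖A (j + 1) - A j‖ ≤ a * θ ^ j) (j : ℕ) :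
    ‖(A (j + 1))⁻¹ - (A j)⁻¹‖ ≤ K ^ 2 * a * θ ^ j := by
  have h := norm_inv_sub_inv_le_of_bounds (A (j + 1)) (A j) (hU (j + 1)) (hU j) (hK (j + 1)) (hK j) (hstep j)
  calc ‖(A (j + 1))⁻¹ - (A j)⁻¹‖ ≤ K * (a * θ ^ j) * K := h
    _ = K ^ 2 * a * θ ^ j := by ring

omit [DecidableEq n] in
/-- [folklore] **GEOMETRIC SANDWICH RATE**: three families with uniform bounds `x, y, z` and one-step rates `dx·θ^j, dy·θ^j, dz·θ^j` have the product rate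
`‖X_{j+1}Y_{j+1}Z_{j+1} − X_jY_jZ_j‖ ≤ (dx·y·z + x·dy·z + x·y·dz)·θ^j` (rectangular factors). -/
theorem norm_mul3_succ_sub_le (X : ℕ → Matrix l m ℂ) (Y : ℕ → Matrix m n ℂ) (Z : ℕ → Matrix n p ℂ)
    {x y z dx dy dz θ : ℝ} (hx : ∀ j, ‖X j‖ ≤ x) (hy : ∀ j, ‖Y j‖ ≤ y) (hz : ∀ j, ‖Z j‖ ≤ z)
    (hdx : ∀ j, ‖X (j + 1) - X j‖ ≤ dx * θ ^ j) (hdy : ∀ j, ‖Y (j + 1) - Y j‖ ≤ dy * θ ^ j)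
    (hdz : ∀ j, ‖Z (j + 1) - Z j‖ ≤ dz * θ ^ j) (j : ℕ) :
    ‖X (j + 1) * Y (j + 1) * Z (j + 1) - X j * Y j * Z j‖ ≤ (dx * y * z + x * dy * z + x * y * dz) * θ ^ j := by
  have h := norm_mul3_sub_mul3_le_of_bounds (X (j + 1)) (X j) (Y (j + 1)) (Y j) (Z (j + 1)) (Z j)
    (hx j) (hy (j + 1)) (hy j) (hz (j + 1)) (hdx j) (hdy j) (hdz j)
  calc ‖X (j + 1) * Y (j + 1) * Z (j + 1) - X j * Y j * Z j‖
      ≤ dx * θ ^ j * y * z + x * (dy * θ ^ j) * z + x * y * (dz * θ ^ j) := h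
    _ = (dx * y * z + x * dy * z + x * y * dz) * θ ^ j := by ring

/-- [folklore] **GEOMETRIC RATE OF A SANDWICHED INVERSE** (the B3/B4 shape `R_j · A_j⁻¹ · S_j` of the capacitance term of S1b′): reading/source families with
bounds `r, s` and rates `dr·θ^j, ds·θ^j`, an invertible family with `‖A_j⁻¹‖ ≤ K` and `‖A_{j+1} − A_j‖ ≤ a·θ^j`, give
`‖R_{j+1}A_{j+1}⁻¹S_{j+1} − R_jA_j⁻¹S_j‖ ≤ (dr·K·s + r·K²a·s + r·K·ds)·θ^j`. -/
theorem norm_sandwich_inv_succ_sub_le (R : ℕ → Matrix l n ℂ) (A : ℕ → Matrix n n ℂ) (S : ℕ → Matrix n p ℂ)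
    (hU : ∀ j, IsUnit (A j).det) {r s K dr ds a θ : ℝ} (hr : ∀ j, ‖R j‖ ≤ r) (hK : ∀ j, ‖(A j)⁻¹‖ ≤ K) (hs : ∀ j, ‖S j‖ ≤ s)
    (hdr : ∀ j, ‖R (j + 1) - R j‖ ≤ dr * θ ^ j) (hstep : ∀ j, ‖A (j + 1) - A j‖ ≤ a * θ ^ j)
    (hds : ∀ j, ‖S (j + 1) - S j‖ ≤ ds * θ ^ j) (j : ℕ) :
    ‖R (j + 1) * (A (j + 1))⁻¹ * S (j + 1) - R j * (A j)⁻¹ * S j‖ ≤ (dr * K * s + r * (K ^ 2 * a) * s + r * K * ds) * θ ^ j :=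
  norm_mul3_succ_sub_le R (fun j => (A j)⁻¹) S hr hK hs hdr (norm_inv_succ_sub_inv_le A hU hK hstep) hds j

end Geometric

/-! ## §5 From one-step rates to tails and limits (any complete normed group) -/

section Tails

variable {E : Type*} [SeminormedAddCommGroup E]

/-- [folklore] **FINITE TELESCOPING**: a one-step rate `‖F_{j+1} − F_j‖ ≤ c·θ^j` with `0 ≤ θ < 1` gives `‖F_{j+k} − F_j‖ ≤ c·θ^j/(1 − θ)` for all `k`. -/
theorem norm_sub_le_of_step_rate (F : ℕ → E) {c θ : ℝ} (hθ0 : 0 ≤ θ) (hθ1 : θ < 1)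
    (h : ∀ j, ‖F (j + 1) - F j‖ ≤ c * θ ^ j) (j k : ℕ) : ‖F (j + k) - F j‖ ≤ c * θ ^ j / (1 - θ) := by
  have hc : 0 ≤ c := by
    have := (norm_nonneg _).trans (h 0)
    simpa using this
  have h1θ : 0 < 1 - θ := by linarith
  -- telescoping with the partial geometric sum
  have main : ∀ k, ‖F (j + k) - F j‖ ≤ c * θ ^ j * (∑ i ∈ Finset.range k, θ ^ i) := by
    intro k
    induction k with
    | zero => simp
    | succ k ih =>
        calc ‖F (j + (k + 1)) - F j‖ = ‖(F (j + k + 1) - F (j + k)) + (F (j + k) - F j)‖ := by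
              rw [← add_assoc]; congr 1; abel
          _ ≤ ‖F (j + k + 1) - F (j + k)‖ + ‖F (j + k) - F j‖ := norm_add_le _ _
          _ ≤ c * θ ^ (j + k) + c * θ ^ j * ∑ i ∈ Finset.range k, θ ^ i := add_le_add (h (j + k)) ih
          _ = c * θ ^ j * ∑ i ∈ Finset.range (k + 1), θ ^ i := by
              rw [Finset.sum_range_succ, pow_add]; ring
  have geo : ∑ i ∈ Finset.range k, θ ^ i ≤ 1 / (1 - θ) := by
    rw [le_div_iff₀ h1θ, geom_sum_mul_neg]
    linarith [pow_nonneg hθ0 k]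
  calc ‖F (j + k) - F j‖ ≤ c * θ ^ j * ∑ i ∈ Finset.range k, θ ^ i := main k
    _ ≤ c * θ ^ j * (1 / (1 - θ)) := by
        exact mul_le_mul_of_nonneg_left geo (mul_nonneg hc (pow_nonneg hθ0 j))
    _ = c * θ ^ j / (1 - θ) := by ring

/-- [folklore] **LIMIT WITH TAIL BOUND** (King (4.41) pattern): in a complete normed group a one-step rate `‖F_{j+1} − F_j‖ ≤ c·θ^j`, `0 ≤ θ < 1`, gives a
limit `F∞` with `‖F_j − F∞‖ ≤ c·θ^j/(1 − θ)` for every `j` (no sign condition on `θ` is needed here: Mathlib's `cauchySeq_of_le_geometric`). -/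
theorem exists_limit_of_step_rate [CompleteSpace E] (F : ℕ → E) {c θ : ℝ} (hθ1 : θ < 1)
    (h : ∀ j, ‖F (j + 1) - F j‖ ≤ c * θ ^ j) :
    ∃ Finf : E, Tendsto F atTop (𝓝 Finf) ∧ ∀ j, ‖F j - Finf‖ ≤ c * θ ^ j / (1 - θ) := by
  have hd : ∀ j, dist (F j) (F (j + 1)) ≤ c * θ ^ j := fun j => by
    rw [dist_comm, dist_eq_norm]; exact h j
  obtain ⟨Finf, hF⟩ := cauchySeq_tendsto_of_complete (cauchySeq_of_le_geometric θ c hθ1 hd)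
  refine ⟨Finf, hF, fun j => ?_⟩
  rw [← dist_eq_norm]
  exact dist_le_of_le_geometric_of_tendsto θ c hθ1 hd hF j

end Tails

end Summit.QuantumFields.BalabanUV.Beta.GAN24.InverseRate
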